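import Mathlib
import Literature.LinearAlgebra.Matrix.BipartiteForestSecondCofactor
import Literature.LinearAlgebra.Matrix.SymmetricBorderDeterminant
import Literature.NumberTheory.EllipticCurves.Smith2016.CongruentNumberGenusDeterminantRowFiveBForest

/-!
# Smith 2016, Theorem 2.2 rows 7(a), 7(b) in forest form (every `k`): the doubly bordered determinants of `M₁`

A. Smith, *The congruent numbers have positive natural density*, arXiv:1603.08479 [Smith2016CongruentDensity],
Table 2 rows 7(a), 7(b) (source `cnc.tex` l. 109–124): for `n ≡ 7 (mod 8)`, with `M₁ = [[A + Aᵀ, Aᵀ],[A, D_z]]`,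
`M_{7a} = [[A + Aᵀ, Aᵀ, y + z, 0],[A, D_z, 0, y],[(y+z)ᵀ, 0, 0, 0],[0, yᵀ, 0, 0]]`,
`M_{7b} = [[A + Aᵀ, Aᵀ, y + z, y],[A, D_z, 0, 0],[(y+z)ᵀ, 0, 0, 0],[yᵀ, 0, 0, 0]]` (`(2r+2) × (2r+2)`), and
`ℒ_{7a}(n) = Σ_{d | n, d ≡ 7 (8)} g(d)ℒ(n/d)`, `ℒ_{7b}(n) = Σ_{d₀d₁ | n, d₀ ≡ 5 (8), d₁ ≡ 3 (8)} g(d₀)g(d₁)ℒ(n/d₀d₁)`;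
§2.2 (source `cnc2.tex` l. 36–52): the double-border expansions (eq:7a_develop) and the `S₀ ⊆ S` sum for 7(b).
Here `y = t = ((−1/pᵢ)₊)`, `z = ((2/pᵢ)₊)`, `A = legendreMatrix p`; the doubly bordered matrices are written as
iterated `fromBlocks` (`[[[[M₁, u],[uᵀ, 0]], (v;0)],[(v;0)ᵀ, 0]]`).

What is proved, for every `k` (and with NO hypothesis on `n` for the forest forms):
* `det_border_border_transport` — the congruence `E = [[I,I],[0,I]]` on the doubly bordered matrix:
  `M₁ ↦ N₁ = bigN a univ z z z`, border columns `b ↦ E b`;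
* `det_sevenB_eq_sum_powerset` — `det M_{7b} = Σ_{B ⊆ [k]} t_B q_z(A^B) · Σ_{B′ ⊆ [k]∖B} (t+z)_{B′} q_z(A^{B′}) · e₁([k]∖B∖B′)`
  (double border of two mark-copy vectors: `BipartiteForestSecondCofactor`), and
  `det_sevenB_eq_sum_genusWeight` — `= Σ_B [d_B ≡ 3 (8)] g(d_B) · Σ_{B′} [d_{B′} ≡ 5 (8)] g(d_{B′}) · ℒ(d_{[k]∖B∖B′})`,
  Smith's `ℒ_{7b}(n)` over index blocks;
* `det_sevenA_eq_sum_powerset` — `det M_{7a}` = the 7(b)-type double sum plus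
  `Σ_B (t+z)_B q_t(A^B) e₁([k]∖B) + Σ_B z_B q_t(A^B) Σ_{B′} (t+z)_{B′} q_z(A^{B′}) e₁` (mark copy + root copy), and
  `det_sevenA_eq_sum_genusWeight` — for `∏ pᵢ ≡ 7 (mod 8)`: `det M_{7a} = Σ_B [d_B ≡ 7 (8)] g(d_B) · ℒ(d_{[k]∖B})`,
  Smith's `ℒ_{7a}(n)` ("the second sum … is zero if `n` equals `7` mod `8`, as `5 · 5 · 1 ≢ 7 (mod 8)`").
The identifications with `Σ₁(n)`, `Σ₂'(n) − Σ₁(n)` and the `2`-Selmer consequences are in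
`CongruentNumberGenusDeterminantRowSevenA` / `…RowSevenB`.
-/

namespace Literature.NumberTheory.EllipticCurves.Smith2016

open _root_.Matrix Finset Literature.LinearAlgebra.Matrix Literature.Combinatorics.Enumerative
open Literature.NumberTheory.EllipticCurves.HeathBrown1994
open Literature.NumberTheory.EllipticCurves.TianYuanZhang2017
open Literature.NumberTheory.EllipticCurves.HeathBrown1994.Families (legendreMatrix_apply_of_ne legendreMatrix_apply_self)
open Literature.NumberTheory.EllipticCurves.MonskySelmerParity

section Transport

variable {V : Type*} [Fintype V] [DecidableEq V]

/-- **Transport of a doubly bordered `M₁`**: with `E = [[I, I],[0, I]]` (`det E = 1`, `E² = I`),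
`det [[[[M₁, b],[bᵀ, 0]], (c;0)],[(c;0)ᵀ, 0]] = det [[[[E M₁ Eᵀ, E b],[(E b)ᵀ, 0]], (E c; 0)],[(E c; 0)ᵀ, 0]]` and
`E M₁ Eᵀ = [[D, Aᵀ + D],[A + D, D]]` for `M₁ = [[A + Aᵀ, Aᵀ],[A, D]]`.
[cite: Smith2016CongruentDensity, §2.2 (source cnc2.tex l. 36–52: the doubly bordered matrices of rows 7(a), 7(b))] [cite: HornJohnson2013, §0.8.5] -/
theorem det_border_border_transport (A D : Matrix V V (ZMod 2)) (b c : V ⊕ V → ZMod 2) :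
    (fromBlocks (fromBlocks (fromBlocks (A + Aᵀ) Aᵀ A D) (replicateCol Unit b) (replicateRow Unit b) 0)
        (replicateCol Unit (Sum.elim c 0)) (replicateRow Unit (Sum.elim c 0)) 0).det =
      (fromBlocks (fromBlocks (fromBlocks D (Aᵀ + D) (A + D) D)
          (replicateCol Unit ((fromBlocks (1 : Matrix V V (ZMod 2)) (1 : Matrix V V (ZMod 2)) (0 : Matrix V V (ZMod 2)) (1 : Matrix V V (ZMod 2))) *ᵥ b))
          (replicateRow Unit ((fromBlocks (1 : Matrix V V (ZMod 2)) (1 : Matrix V V (ZMod 2)) (0 : Matrix V V (ZMod 2)) (1 : Matrix V V (ZMod 2))) *ᵥ b)) 0)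
        (replicateCol Unit (Sum.elim ((fromBlocks (1 : Matrix V V (ZMod 2)) (1 : Matrix V V (ZMod 2)) (0 : Matrix V V (ZMod 2)) (1 : Matrix V V (ZMod 2))) *ᵥ c) 0))
        (replicateRow Unit (Sum.elim ((fromBlocks (1 : Matrix V V (ZMod 2)) (1 : Matrix V V (ZMod 2)) (0 : Matrix V V (ZMod 2)) (1 : Matrix V V (ZMod 2))) *ᵥ c) 0)) 0).det := by
  set E := (fromBlocks (1 : Matrix V V (ZMod 2)) (1 : Matrix V V (ZMod 2)) (0 : Matrix V V (ZMod 2)) (1 : Matrix V V (ZMod 2))) with hE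
  have hEt : Eᵀ = fromBlocks (1 : Matrix V V (ZMod 2)) 0 1 1 := by
    rw [hE, fromBlocks_transpose, transpose_one, transpose_zero]
  have hdetE : E.det = 1 := by rw [hE, det_fromBlocks_zero₂₁, det_one, mul_one]
  have hconj : E * fromBlocks (A + Aᵀ) Aᵀ A D * Eᵀ = fromBlocks D (Aᵀ + D) (A + D) D := by
    rw [hEt, hE, conj_fromBlocks_add_transpose]
  set P := fromBlocks E 0 0 (1 : Matrix Unit Unit (ZMod 2)) with hP
  have hdetP : P.det = 1 := by rw [hP, det_fromBlocks_zero₂₁, hdetE, det_one, mul_one]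
  have hPc : P *ᵥ Sum.elim c 0 = Sum.elim (E *ᵥ c) 0 := by
    rw [hP, fromBlocks_mulVec]
    ext (i | i) <;> simp
  rw [← hconj, ← fromBlocks_border_conj E, ← hPc, det_fromBlocks_border_conj P, hdetP, one_mul, one_mul]

/-- `E (u; 0) = (u; 0)` and `E (0; w) = (w; w)` for `E = [[I, I],[0, I]]`. [cite: Smith2016CongruentDensity, §2.2] -/
theorem fromBlocks_one_one_zero_one_mulVec_elim (u w : V → ZMod 2) :
    (fromBlocks (1 : Matrix V V (ZMod 2)) (1 : Matrix V V (ZMod 2)) (0 : Matrix V V (ZMod 2)) (1 : Matrix V V (ZMod 2))) *ᵥ Sum.elim u w = Sum.elim (u + w) w := by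
  rw [fromBlocks_mulVec]
  ext (i | i) <;> simp

end Transport

variable {k : ℕ} (p : Fin k → ℕ)

section SevenForest

/-- **`det M_{7b}` as a double sum of second-order minors of `N₁`** (every `k`): with `t = ((−1/pᵢ)₊)`,
`z = ((2/pᵢ)₊)`, `N₁ = bigN a univ z z z`, `det M_{7b} = Σ_j Σ_{i ≠ j} t_j (t+z)_i det(N₁ with the mark copies of i, j unitized)`.
[cite: Smith2016CongruentDensity, Thm. 2.2 row 7(b) / Table 2 (source cnc.tex l. 117–124) and §2.2 (cnc2.tex l. 36–42)] -/
theorem det_sevenB_eq_sum_sum :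
    (fromBlocks (fromBlocks (fromBlocks (legendreMatrix p + (legendreMatrix p)ᵀ) (legendreMatrix p)ᵀ (legendreMatrix p)
          (legendreDiagonal p 2))
        (replicateCol Unit (Sum.elim (fun i => addLegendreSym (-1) (p i) + addLegendreSym 2 (p i)) (0 : Fin k → ZMod 2)))
        (replicateRow Unit (Sum.elim (fun i => addLegendreSym (-1) (p i) + addLegendreSym 2 (p i)) (0 : Fin k → ZMod 2))) 0)
      (replicateCol Unit (Sum.elim (Sum.elim (fun i => addLegendreSym (-1) (p i)) (0 : Fin k → ZMod 2)) 0))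
      (replicateRow Unit (Sum.elim (Sum.elim (fun i => addLegendreSym (-1) (p i)) (0 : Fin k → ZMod 2)) 0)) 0).det =
      ∑ j, ∑ i ∈ univ.erase j, addLegendreSym (-1) (p j) * (addLegendreSym (-1) (p i) + addLegendreSym 2 (p i)) *
        (unitize (unitize (bigN (fun i j => legendreMatrix p i j) univ (fun i => addLegendreSym 2 (p i))
          (fun i => addLegendreSym 2 (p i)) (fun i => addLegendreSym 2 (p i))) (Sum.inl i)) (Sum.inl j)).det := by
  have hD2 : legendreDiagonal p 2 = diagonal fun i => addLegendreSym 2 (p i) := rfl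
  have hNeq : fromBlocks (legendreDiagonal p 2) ((legendreMatrix p)ᵀ + legendreDiagonal p 2)
      (legendreMatrix p + legendreDiagonal p 2) (legendreDiagonal p 2) =
      bigN (fun i j => legendreMatrix p i j) univ (fun i => addLegendreSym 2 (p i))
        (fun i => addLegendreSym 2 (p i)) (fun i => addLegendreSym 2 (p i)) := by
    rw [bigN_univ_eq_fromBlocks _ (legendreMatrix_apply_self p), hD2, transpose_add, diagonal_transpose]
  rw [det_border_border_transport, fromBlocks_one_one_zero_one_mulVec_elim, fromBlocks_one_one_zero_one_mulVec_elim,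
    add_zero, add_zero, hNeq, det_fromBlocks_border_border (bigN_transpose _ _ _ _ _), Fintype.sum_sum_type]
  simp only [Sum.elim_inl, Sum.elim_inr, Pi.zero_apply, zero_mul, sum_const_zero, add_zero]
  refine sum_congr rfl fun j _ => ?_
  rw [mul_sum, Fintype.sum_sum_type]
  simp only [Sum.elim_inl, Sum.elim_inr, Pi.zero_apply, ite_self, zero_mul, mul_zero, sum_const_zero, add_zero]
  rw [← add_sum_erase _ _ (mem_univ j), if_pos rfl, zero_mul, mul_zero, zero_add]
  refine sum_congr rfl fun i hi => ?_
  rw [if_neg (fun h => (ne_of_mem_erase hi) (Sum.inl_injective h)), unitize_comm]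
  ring

/-- **`det M_{7b}` as a double pointed forest sum** (every `k`):
`det M_{7b} = Σ_{B ⊆ [k]} t_B q_z(A^B) · Σ_{B′ ⊆ [k]∖B} (t+z)_{B′} q_z(A^{B′}) · e₁([k]∖B∖B′)` — Smith's
`Σ_{S₀ ⊆ S} det O(A, z, y)[S₀] · det O(A, z, y+z)[S − S₀] · det M₁[S′]`.
[cite: Smith2016CongruentDensity, §2.2 (source cnc2.tex l. 36–42)] [cite: Chaiken1982, §2] -/
theorem det_sevenB_eq_sum_powerset :
    (fromBlocks (fromBlocks (fromBlocks (legendreMatrix p + (legendreMatrix p)ᵀ) (legendreMatrix p)ᵀ (legendreMatrix p)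
          (legendreDiagonal p 2))
        (replicateCol Unit (Sum.elim (fun i => addLegendreSym (-1) (p i) + addLegendreSym 2 (p i)) (0 : Fin k → ZMod 2)))
        (replicateRow Unit (Sum.elim (fun i => addLegendreSym (-1) (p i) + addLegendreSym 2 (p i)) (0 : Fin k → ZMod 2))) 0)
      (replicateCol Unit (Sum.elim (Sum.elim (fun i => addLegendreSym (-1) (p i)) (0 : Fin k → ZMod 2)) 0))
      (replicateRow Unit (Sum.elim (Sum.elim (fun i => addLegendreSym (-1) (p i)) (0 : Fin k → ZMod 2)) 0)) 0).det =
      ∑ B ∈ (univ : Finset (Fin k)).powerset, (∑ m ∈ B, addLegendreSym (-1) (p m)) *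
        qwt (fun i j => legendreMatrix p i j) (fun i => addLegendreSym 2 (p i)) B *
        ∑ B' ∈ (univ \ B).powerset, (∑ m ∈ B', (addLegendreSym (-1) (p m) + addLegendreSym 2 (p m))) *
          qwt (fun i j => legendreMatrix p i j) (fun i => addLegendreSym 2 (p i)) B' *
          setExp (fwt (fun i j => legendreMatrix p i j) (fun i => addLegendreSym 2 (p i))
            (fun i => addLegendreSym 2 (p i)) (fun i => addLegendreSym 2 (p i))) ((univ \ B) \ B') := by
  rw [det_sevenB_eq_sum_sum,
    ← sum_sum_mul_det_unitize_unitize_inl_inl _ univ _ _ _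
      (fun i => addLegendreSym (-1) (p i) + addLegendreSym 2 (p i)) (fun j => addLegendreSym (-1) (p j))]

/-- **The row-5(a) pointed weight with the empty block allowed**: `(Σ_B (t + z)) q_z(A^B) = [d_B ≡ 5 (8)] g(d_B)`.
[cite: Smith2016CongruentDensity, §2.2 (chunk p0008 L50–L55: "Taking u = y + z … d must be 5 mod 8")] -/
theorem pointedWeight_five_legendre_eq_genusWeight' (hp : ∀ i, (p i).Prime) (hodd : ∀ i, Odd (p i))
    (hinj : Function.Injective p) (B : Finset (Fin k)) :
    (∑ m ∈ B, (addLegendreSym (-1) (p m) + addLegendreSym 2 (p m))) *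
        qwt (fun i j => legendreMatrix p i j) (fun i => addLegendreSym 2 (p i)) B =
      if (∏ i ∈ B, p i) % 8 = 5 then ((genusClassNumber (GenusField (∏ i ∈ B, p i)) : ℕ) : ZMod 2) else 0 := by
  rcases B.eq_empty_or_nonempty with rfl | hB
  · rw [sum_empty, zero_mul, prod_empty, if_neg (by norm_num)]
  rw [sum_add_distrib, add_mul, pointedWeight_legendre_eq_genusWeight p hp hodd hinj hB,
    sum_addLegendreSym_two_block_eq p hodd B, qwt_legendre_eq_genusWeight p hp hodd hinj hB]
  have h2 := blockProd_mod_two p hp hodd B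
  by_cases h3 : (∏ i ∈ B, p i) % 8 = 3
  · rw [if_pos h3, if_pos (Or.inl h3), if_neg (show ¬ (∏ i ∈ B, p i) % 4 = 1 by omega),
      if_neg (show ¬ (∏ i ∈ B, p i) % 8 = 5 by omega), one_mul]
    exact CharTwo.add_self_eq_zero _
  · rw [if_neg h3]
    by_cases h5 : (∏ i ∈ B, p i) % 8 = 5
    · rw [if_pos (Or.inr h5), if_pos (show (∏ i ∈ B, p i) % 4 = 1 by omega), if_pos h5, one_mul, zero_add]
    · rw [if_neg (show ¬ ((∏ i ∈ B, p i) % 8 = 3 ∨ (∏ i ∈ B, p i) % 8 = 5) by omega), if_neg h5, zero_mul,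
        zero_add]

/-- **`det M_{7b}` in genus class numbers, every `k`** (no hypothesis on `n`):
`det M_{7b} = Σ_{B ⊆ [k], d_B ≡ 3 (8)} g(d_B) · Σ_{B′ ⊆ [k]∖B, d_{B′} ≡ 5 (8)} g(d_{B′}) · ℒ(d_{[k]∖B∖B′})` — Smith's
`ℒ_{7b}(n) = Σ_{d₀d₁ | n, d₀ ≡ 5, d₁ ≡ 3 (8)} g(d₀)g(d₁)ℒ(n/d₀d₁)` over index blocks.
[cite: Smith2016CongruentDensity, Thm. 2.2 row 7(b) / Table 2 (source cnc.tex l. 117–124) and §2.2 (cnc2.tex l. 36–42)] -/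
theorem det_sevenB_eq_sum_genusWeight (hp : ∀ i, (p i).Prime) (hodd : ∀ i, Odd (p i))
    (hinj : Function.Injective p) :
    (fromBlocks (fromBlocks (fromBlocks (legendreMatrix p + (legendreMatrix p)ᵀ) (legendreMatrix p)ᵀ (legendreMatrix p)
          (legendreDiagonal p 2))
        (replicateCol Unit (Sum.elim (fun i => addLegendreSym (-1) (p i) + addLegendreSym 2 (p i)) (0 : Fin k → ZMod 2)))
        (replicateRow Unit (Sum.elim (fun i => addLegendreSym (-1) (p i) + addLegendreSym 2 (p i)) (0 : Fin k → ZMod 2))) 0)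
      (replicateCol Unit (Sum.elim (Sum.elim (fun i => addLegendreSym (-1) (p i)) (0 : Fin k → ZMod 2)) 0))
      (replicateRow Unit (Sum.elim (Sum.elim (fun i => addLegendreSym (-1) (p i)) (0 : Fin k → ZMod 2)) 0)) 0).det =
      ∑ B ∈ (univ : Finset (Fin k)).powerset,
        (if (∏ i ∈ B, p i) % 8 = 3 then ((genusClassNumber (GenusField (∏ i ∈ B, p i)) : ℕ) : ZMod 2) else 0) *
        ∑ B' ∈ (univ \ B).powerset,
          (if (∏ i ∈ B', p i) % 8 = 5 then ((genusClassNumber (GenusField (∏ i ∈ B', p i)) : ℕ) : ZMod 2) else 0) *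
          ∑ D ∈ decompositions (∏ i ∈ (univ \ B) \ B', p i), ∏ d ∈ D,
            (if d % 8 = 1 then ((genusClassNumber (GenusField d) : ℕ) : ZMod 2) else 0) := by
  rw [det_sevenB_eq_sum_powerset]
  refine sum_congr rfl fun B _ => ?_
  rw [pointedWeight_legendre_eq_genusWeight' p hp hodd hinj B]
  congr 1
  refine sum_congr rfl fun B' _ => ?_
  rw [pointedWeight_five_legendre_eq_genusWeight' p hp hodd hinj B',
    setExp_fwt_legendre_eq_sum_decompositions p hp hodd hinj ((univ \ B) \ B')]

end SevenForest

end Literature.NumberTheory.EllipticCurves.Smith2016
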